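import Literature.NumberTheory.LFunctions.AutomaticSequenceTransducerArith
import HarnessLib

/-!
# Arithmetic restrictions for the naturally induced transducer, II: `d(q,q̄)` divides `k^{ℓ₀}(k^d − 1)` (Müllner 2017, Lemma 2.18; proved)

Everything in this file is PROVED (plus one plain definition). It continues §2.4 of C. Müllner,
*Automatic sequences fulfill the Sarnak conjecture* (Duke Math. J. 166 (2017)) over the digit
alphabet (`k ≥ 2`, letters `≥ k` trivial), with `d = transducerPeriod k δ`:

* `MinImage.exists_uniform_sync` — the Remark before Lemma 2.18: a length `ℓ₀` and, for every
  state `M`, a digit word `w_M ∈ Σ^{ℓ₀}` with `δ(X, w_M) = M` for ALL states `X`;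
* `MinImage.limitDiffGcd hk htriv M M' c` — the stable value `d(q, q̄)` of `d_{g,ℓ}` on the class
  `c` (Lemma 2.17, `exists_diffGcd_eq`), with its specification lemmas;
* `MinImage.int_dvd_sub_of_mem_pathVals` — on a stabilised length all numbers `[w]_k` of paths with
  the same output are congruent modulo `d(q,q̄)` (so Müllner's `r_ℓ^{q q̄}(g)` is well defined);
* **Lemma 2.18** (`MinImage.exists_limitDiffGcd_dvd`): `d(q,q̄) ∣ k^{ℓ₀} (k^d − 1)` — sandwich a
  path between identity loops of length `d m₁` on either side, compare the paths `0⋯0 0 w_{q̄}` and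
  `0⋯0 1 w_{q̄}`, then compare `m₁` with `m₁ + 1`.

## References
* C. Müllner, Duke Math. J. 166 (2017), §2.4: Remark before Lemma 2.18, Lemma 2.18. [Mullner2017]
-/

noncomputable section

open Finset

namespace Literature.NumberTheory.LFunctions

namespace MinImage

variable {σ : Type*} [Fintype σ] [DecidableEq σ] {δ : σ → ℕ → σ} {k : ℕ}

/-! ## Uniform synchronizing words -/

/-- **Uniform synchronizing words** (Müllner, Remark before Lemma 2.18): there is `ℓ₀` such that
every state `M` is reached from EVERY state by one digit word `w_M` of length exactly `ℓ₀` (zeros,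
a minimising word, then a path from the base image to `M`). [cite: Mullner2017, §2.4 (Remark before Lemma 2.18)] -/
theorem exists_uniform_sync (hk : 0 < k) (htriv : ∀ q d, k ≤ d → δ q d = q) :
    ∃ ℓ₀ : ℕ, ∀ M : MinImage δ, ∃ u : List ℕ, (∀ d ∈ u, d < k) ∧ u.length = ℓ₀ ∧
      ∀ X : MinImage δ, X.next u = M := by
  obtain ⟨w₁, h₁⟩ := exists_card_fullImage_eq_minRank δ
  set w₀ := w₁.filter (· < k) with hw₀
  have h₀ : (fullImage δ w₀).card = minRank δ := by rw [hw₀, fullImage_filter htriv]; exact h₁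
  have hw₀d : ∀ d ∈ w₀, d < k := fun d hd => mem_filter_lt hd
  set M₀ : MinImage δ := ⟨fullImage δ w₀, fullImage_mem_minImages h₀⟩ with hM₀
  have hu : ∀ M' : MinImage δ, ∃ u : List ℕ, (∀ d ∈ u, d < k) ∧ M₀.next u = M' := fun M' => by
    obtain ⟨u, hu⟩ := exists_image_eq M₀.2 M'.2
    exact ⟨u.filter (· < k), fun d hd => mem_filter_lt hd,
      by rw [next_filter htriv]; exact Subtype.ext hu⟩
  choose u hud hu using hu
  refine ⟨w₀.length + univ.sup fun M' => (u M').length, fun M => ?_⟩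
  have hle : (u M).length ≤ univ.sup fun M' => (u M').length :=
    le_sup (f := fun M' => (u M').length) (mem_univ M)
  refine ⟨List.replicate ((univ.sup fun M' => (u M').length) - (u M).length) 0 ++ w₀ ++ u M,
    ?_, ?_, fun X => ?_⟩
  · refine digits_append (digits_append (fun d hd => ?_) hw₀d) (hud M)
    rw [List.eq_of_mem_replicate hd]; exact hk
  · simp only [List.length_append, List.length_replicate]
    omega
  · rw [next_append, next_append, next_eq_of_minimising _ h₀, ← hM₀, hu]

/-! ## `d(q, q̄)` and the congruence of the numbers of paths -/

/-- `d(q, q̄)` on the class `c`: the stable value of `d_{g,ℓ}` (Lemma 2.17, `exists_diffGcd_eq`).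
[cite: Mullner2017, Lemma 2.17] -/
def limitDiffGcd (hk : 2 ≤ k) (htriv : ∀ q d, k ≤ d → δ q d = q) (M M' : MinImage δ)
    (c : ZMod (transducerPeriod k δ)) : ℕ :=
  (exists_diffGcd_eq hk htriv M M' c).choose

/-- `d(q, q̄) > 0`. [cite: Mullner2017, Lemma 2.17] -/
theorem limitDiffGcd_pos (hk : 2 ≤ k) (htriv : ∀ q d, k ≤ d → δ q d = q) (M M' : MinImage δ)
    (c : ZMod (transducerPeriod k δ)) : 0 < M.limitDiffGcd hk htriv M' c :=
  (exists_diffGcd_eq hk htriv M M' c).choose_spec.1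

/-- The defining property of `d(q, q̄)`: `d_{g,ℓ} = d(q,q̄)` for all `g` in the class and all
lengths `c.val + K d` with `K ≥ m₀'`. [cite: Mullner2017, Lemma 2.17] -/
theorem exists_forall_diffGcd_eq_limitDiffGcd (hk : 2 ≤ k) (htriv : ∀ q d, k ≤ d → δ q d = q)
    (M M' : MinImage δ) (c : ZMod (transducerPeriod k δ)) :
    ∃ m₀' : ℕ, ∀ g ∈ M.pathOutputs k M' c, ∀ K : ℕ, m₀' ≤ K →
      M.diffGcd k M' g (c.val + K * transducerPeriod k δ) = M.limitDiffGcd hk htriv M' c :=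
  (exists_diffGcd_eq hk htriv M M' c).choose_spec.2

/-- **The numbers of paths with the same output are congruent modulo `d_{g,ℓ}`** (by definition of
the gcd of differences; Müllner: "`r_ℓ^{q q̄}(g)` … does not depend on the choice of `w`").
[cite: Mullner2017, §2.4 (definition of r_ℓ)] -/
theorem int_dvd_sub_of_mem_pathVals {M M' : MinImage δ} {g : Equiv.Perm (Fin (minRank δ))}
    {L x y : ℕ} (hx : x ∈ M.pathVals k M' g L) (hy : y ∈ M.pathVals k M' g L) :
    (M.diffGcd k M' g L : ℤ) ∣ (x : ℤ) - y := by
  rcases le_or_gt y x with h | h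
  · have := Nat.setGcd_dvd_of_mem (s := {z | ∃ x ∈ M.pathVals k M' g L,
      ∃ y ∈ M.pathVals k M' g L, y ≤ x ∧ z = x - y}) ⟨x, hx, y, hy, h, rfl⟩
    rw [diffGcd]
    have := Int.natCast_dvd_natCast.2 this
    rwa [Nat.cast_sub h] at this
  · have := Nat.setGcd_dvd_of_mem (s := {z | ∃ x ∈ M.pathVals k M' g L,
      ∃ y ∈ M.pathVals k M' g L, y ≤ x ∧ z = x - y}) ⟨y, hy, x, hx, h.le, rfl⟩
    rw [diffGcd]
    have := Int.natCast_dvd_natCast.2 this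
    rw [Nat.cast_sub h.le] at this
    rwa [← dvd_neg, neg_sub] at this

/-! ## Lemma 2.18 -/

/-- Values of the test words: `[0^j b u]_k = b k^{|u|} + [u]_k`. [folklore] -/
theorem wordVal_replicate_zero_append_cons (k j b : ℕ) (u : List ℕ) :
    wordVal k (List.replicate j 0 ++ b :: u) = b * k ^ u.length + wordVal k u := by
  rw [show List.replicate j 0 ++ b :: u = (List.replicate j 0 ++ [b]) ++ u by simp,
    wordVal_append, wordVal_append]
  have h0 : wordVal k (List.replicate j 0) = 0 := by
    rw [wordVal, List.reverse_replicate, Nat.ofDigits_replicate_zero]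
  rw [h0, zero_mul, zero_add]
  simp [wordVal]

/-- The sandwich congruence (Müllner, proof of Lemma 2.18, first display): if `w₁` and `w₂` are
identity loops at `M` and `M'` of the same length `P`, and `w` is a path from `M` to `M'` of length
`m₂`, then `[w₁ w]_k − [w w₂]_k = [w₁]_k k^{m₂} − [w₂]_k − [w]_k (k^P − 1)` is divisible by
`d_{T(M,w), P + m₂}`. [cite: Mullner2017, Lemma 2.18 (proof)] -/
theorem int_diffGcd_dvd_sandwich {M M' : MinImage δ} {w w₁ w₂ : List ℕ} {P m₂ : ℕ}
    (hwd : ∀ d ∈ w, d < k) (hwl : w.length = m₂) (hwn : M.next w = M')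
    (h₁d : ∀ d ∈ w₁, d < k) (h₁l : w₁.length = P) (h₁ : M.IsIdLoop w₁)
    (h₂d : ∀ d ∈ w₂, d < k) (h₂l : w₂.length = P) (h₂ : M'.IsIdLoop w₂) :
    (M.diffGcd k M' (M.T w) (P + m₂) : ℤ) ∣
      ((wordVal k w₁ : ℤ) * k ^ m₂ - wordVal k w₂) - (wordVal k w : ℤ) * (k ^ P - 1) := by
  have hx : wordVal k w₁ * k ^ m₂ + wordVal k w ∈ M.pathVals k M' (M.T w) (P + m₂) := by
    refine ⟨w₁ ++ w, digits_append h₁d hwd, by rw [List.length_append, h₁l, hwl], ?_, ?_, ?_⟩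
    · rw [next_append, h₁.1, hwn]
    · rw [T_append, h₁.1, h₁.2]; rfl
    · rw [wordVal_append, hwl]
  have hy : wordVal k w * k ^ P + wordVal k w₂ ∈ M.pathVals k M' (M.T w) (P + m₂) := by
    refine ⟨w ++ w₂, digits_append hwd h₂d, by rw [List.length_append, h₂l, hwl, add_comm], ?_, ?_, ?_⟩
    · rw [next_append, hwn, h₂.1]
    · rw [T_append, hwn, h₂.2]; rfl
    · rw [wordVal_append, h₂l]
  have := int_dvd_sub_of_mem_pathVals hx hy
  push_cast at this
  convert this using 1
  ring

/-- **Müllner 2017, Lemma 2.18**: `d(q, q̄) ∣ k^{ℓ₀} (k^d − 1)` for all states and classes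
(`k ≥ 2`; `ℓ₀` from `exists_uniform_sync`). [cite: Mullner2017, Lemma 2.18] -/
theorem exists_limitDiffGcd_dvd (hk : 2 ≤ k) (htriv : ∀ q d, k ≤ d → δ q d = q) :
    ∃ ℓ₀ : ℕ, ∀ (M M' : MinImage δ) (c : ZMod (transducerPeriod k δ)),
      M.limitDiffGcd hk htriv M' c ∣ k ^ ℓ₀ * (k ^ transducerPeriod k δ - 1) := by
  have hk0 : 0 < k := by omega
  have hk1 : 1 < k := hk
  obtain ⟨ℓ₀, hℓ₀⟩ := exists_uniform_sync hk0 htriv (δ := δ)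
  refine ⟨ℓ₀, fun M M' c => ?_⟩
  haveI : NeZero (transducerPeriod k δ) := ⟨(transducerPeriod_pos hk0 htriv).ne'⟩
  set D := M.limitDiffGcd hk htriv M' c with hDdef
  obtain ⟨m₀', hm₀'⟩ := M.exists_forall_diffGcd_eq_limitDiffGcd hk htriv M' c
  obtain ⟨mM, hmM⟩ := M.exists_forall_exists_loop_eq hk0 htriv
  obtain ⟨mM', hmM'⟩ := M'.exists_forall_exists_loop_eq hk0 htriv
  obtain ⟨u, hud, hul, hu⟩ := hℓ₀ M'
  -- the test paths `0^j b u` (b = 0, 1) of length `m₂ = c.val + K₂ d ≥ ℓ₀ + 1`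
  set K₂ := m₀' + ℓ₀ + 1 with hK₂
  set m₂ := c.val + K₂ * transducerPeriod k δ with hm₂
  have hm₂ge : ℓ₀ + 1 ≤ m₂ := by
    have : K₂ ≤ K₂ * transducerPeriod k δ := Nat.le_mul_of_pos_right _ (transducerPeriod_pos hk0 htriv)
    omega
  set j := m₂ - (ℓ₀ + 1) with hj
  have path : ∀ b : ℕ, b < k → (∀ d ∈ List.replicate j 0 ++ b :: u, d < k) ∧
      (List.replicate j 0 ++ b :: u).length = m₂ ∧ M.next (List.replicate j 0 ++ b :: u) = M' := by
    intro b hb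
    refine ⟨digits_append (fun d hd => by rw [List.eq_of_mem_replicate hd]; exact hk0)
        (fun d hd => ?_), ?_, ?_⟩
    · rcases List.mem_cons.1 hd with rfl | h
      · exact hb
      · exact hud d h
    · simp only [List.length_append, List.length_replicate, List.length_cons, hul]; omega
    · rw [next_append, show b :: u = [b] ++ u from rfl, next_append]
      exact hu _
  -- the divisibility `D ∣ k^{ℓ₀} (k^{P} - 1)` for every `P = n d`, `n ≥ max mM mM'`
  have key : ∀ n : ℕ, max mM mM' ≤ n →
      (D : ℤ) ∣ (k : ℤ) ^ ℓ₀ * ((k : ℤ) ^ (n * transducerPeriod k δ) - 1) := by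
    intro n hn
    obtain ⟨w₁, h₁d, h₁l, h₁n, h₁T⟩ := hmM n ((le_max_left _ _).trans hn) 1 (Subgroup.one_mem _)
    obtain ⟨w₂, h₂d, h₂l, h₂n, h₂T⟩ := hmM' n ((le_max_right _ _).trans hn) 1 (Subgroup.one_mem _)
    set P := n * transducerPeriod k δ with hP
    -- stabilised: `P + m₂ = c.val + (n + K₂) d` with `n + K₂ ≥ m₀'`
    have hstab : ∀ b : ℕ, b < k → M.diffGcd k M' (M.T (List.replicate j 0 ++ b :: u)) (P + m₂) = D := by
      intro b hb
      obtain ⟨hpd, hpl, hpn⟩ := path b hb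
      have hg : M.T (List.replicate j 0 ++ b :: u) ∈ M.pathOutputs k M' c := by
        have := M.T_mem_pathOutputs hpd (k := k)
        rwa [hpn, hpl, hm₂, Nat.cast_add, Nat.cast_mul, ZMod.natCast_self, mul_zero, add_zero,
          ZMod.natCast_zmod_val] at this
      have := hm₀' _ hg (n + K₂) (by omega)
      rwa [show c.val + (n + K₂) * transducerPeriod k δ = P + m₂ by rw [hP, hm₂]; ring] at this
    have hsand : ∀ b : ℕ, b < k → (D : ℤ) ∣
        ((wordVal k w₁ : ℤ) * k ^ m₂ - wordVal k w₂) -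
          (wordVal k (List.replicate j 0 ++ b :: u) : ℤ) * ((k : ℤ) ^ P - 1) := by
      intro b hb
      obtain ⟨hpd, hpl, hpn⟩ := path b hb
      have := int_diffGcd_dvd_sandwich hpd hpl hpn h₁d h₁l ⟨h₁n, h₁T⟩ h₂d h₂l ⟨h₂n, h₂T⟩
      rwa [hstab b hb] at this
    have h0 := hsand 0 hk0
    have h1 := hsand 1 hk1
    have hdiff := dvd_sub h0 h1
    have heq : ((wordVal k w₁ : ℤ) * k ^ m₂ - wordVal k w₂ -
        ((0 * k ^ u.length + wordVal k u : ℕ) : ℤ) * ((k : ℤ) ^ P - 1)) -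
        ((wordVal k w₁ : ℤ) * k ^ m₂ - wordVal k w₂ -
        ((1 * k ^ u.length + wordVal k u : ℕ) : ℤ) * ((k : ℤ) ^ P - 1)) =
        (k : ℤ) ^ ℓ₀ * ((k : ℤ) ^ P - 1) := by
      rw [hul]; push_cast; ring
    rw [wordVal_replicate_zero_append_cons, wordVal_replicate_zero_append_cons, heq] at hdiff
    exact hdiff
  -- compare `n` and `n + 1`
  set n := max mM mM' with hn
  have hA := key n le_rfl
  have hB := key (n + 1) (Nat.le_succ _)
  have hC : (D : ℤ) ∣ (k : ℤ) ^ ℓ₀ * ((k : ℤ) ^ transducerPeriod k δ - 1) := by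
    have := dvd_sub hB (dvd_mul_of_dvd_left hA ((k : ℤ) ^ transducerPeriod k δ))
    have heq : (k : ℤ) ^ ℓ₀ * ((k : ℤ) ^ ((n + 1) * transducerPeriod k δ) - 1) -
        (k : ℤ) ^ ℓ₀ * ((k : ℤ) ^ (n * transducerPeriod k δ) - 1) * (k : ℤ) ^ transducerPeriod k δ =
        (k : ℤ) ^ ℓ₀ * ((k : ℤ) ^ transducerPeriod k δ - 1) := by
      rw [add_mul, one_mul, pow_add]; ring
    rw [heq] at this
    exact this
  have hk1' : 1 ≤ k ^ transducerPeriod k δ := Nat.one_le_pow _ _ hk0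
  rw [← Int.natCast_dvd_natCast]
  push_cast [Nat.cast_sub hk1']
  exact hC

end MinImage

end Literature.NumberTheory.LFunctions
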